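import Mathlib
import Summits.Ventures.HodgeRepro2.PeterssonSpace

/-!
# HolomorphicPeterssonSpace — the holomorphic weight-`k` forms inside the Petersson space are
Hecke-stable, and carry a joint Hecke eigenbasis once finite-dimensional

Blind cell `pub-hodge-repro2`, seat p2 (Tier 5 kernel support, Hecke side of N1 §ID-3 / N3 / N5).

* `differentiableOn_hecke`: the Hecke operator `T_δ` (a finite sum of slash operators,
  `HeckeSlashOperator.lean`) preserves holomorphy on the ball (`SlashOperator.differentiableOn_slash`);
* `holomorphicForms` / `holomorphicSpace`: the holomorphic weight-`k` forms for `S` as a subspace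
  of `PeterssonForms`, and its image in the Petersson space `S_k(S) ⊂ L²_k`;
* the image is stable under every Hecke operator `T_δ`, `δ ∈ U(H)(K)`;
* `exists_orthonormalBasis_heckeSpace_holomorphic`: if the holomorphic subspace is
  finite-dimensional (the finiteness of `S_k(Γ)` on a compact quotient — prose, carried as an
  instance hypothesis) and the Hecke operators of a family closed under inversion commute, the
  holomorphic subspace has an ORTHONORMAL BASIS of simultaneous Hecke eigenforms.
-/

namespace Summit.Ventures.HodgeRepro2.ShimuraData

open JointEigenbasis SeparationQuotientOperators

variable {K : Type*} [Field K] [NumberField K] [NumberField.IsCMField K] {τ₁ : K →+* ℂ}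
  {H : Matrix (Fin 3) (Fin 3) K} {Q : Matrix (Fin 3) (Fin 3) ℂ}

/-- **Hecke operators preserve holomorphy**: `T_δ f` is holomorphic on the ball when `f` is
(`T_δ f = Σ_q f ∥_k (δ r_q)`, each slash holomorphic). -/
theorem differentiableOn_hecke (hQ : IsFrame K τ₁ H Q) {S : Subgroup (GL (Fin 3) K)}
    (hS : (S : Set (GL (Fin 3) K)) ⊆ unitaryGroup K H) (k : ℕ) {δ : GL (Fin 3) K}
    (hδ : δ ∈ unitaryGroup K H) [Fintype (S ⧸ (heckeSubgroup S δ).subgroupOf S)]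
    {f : (Fin 2 → ℂ) → ℂ} (hf : DifferentiableOn ℂ f ball₂) :
    DifferentiableOn ℂ (hecke S δ τ₁ Q k f) ball₂ := by
  have h : hecke S δ τ₁ Q k f
      = ∑ q, slash k (realEmbedding K τ₁ Q (δ * (heckeRep S δ q : GL (Fin 3) K))) f := by
    funext z
    simp only [hecke, Finset.sum_apply]
  rw [h]
  exact DifferentiableOn.sum fun q _ => differentiableOn_slash k
    (IsFrame.isInU21_realEmbedding hQ (mul_mem hδ (hS (heckeRep S δ q).2))) hf

variable (hQ : IsFrame K τ₁ H Q) (S : Subgroup (GL (Fin 3) K))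
  (hS : (S : Set (GL (Fin 3) K)) ⊆ unitaryGroup K H) [CompactSpace (ballQuotient hQ S hS)]
  {D : Set ball₂} (k : ℕ) (hD : IsBallFundamentalDomain hQ S hS D)

/-- The holomorphic weight-`k` forms for `S`, as a subspace of the Petersson pre-inner-product
space of continuous weight-`k` forms. -/
noncomputable def holomorphicForms : Submodule ℂ (PeterssonForms hQ S hS k hD) where
  carrier := {f | DifferentiableOn ℂ
    (PeterssonForms.toForm hQ S hS k hD f : (Fin 2 → ℂ) → ℂ) ball₂}
  add_mem' := fun {f g} hf hg => by
    change DifferentiableOn ℂ ((PeterssonForms.toForm hQ S hS k hD f : (Fin 2 → ℂ) → ℂ)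
      + (PeterssonForms.toForm hQ S hS k hD g : (Fin 2 → ℂ) → ℂ)) ball₂
    exact hf.add hg
  zero_mem' := by
    change DifferentiableOn ℂ (0 : (Fin 2 → ℂ) → ℂ) ball₂
    exact differentiableOn_const 0
  smul_mem' := fun c {f} hf => by
    change DifferentiableOn ℂ (c • (PeterssonForms.toForm hQ S hS k hD f : (Fin 2 → ℂ) → ℂ)) ball₂
    exact hf.const_smul c

/-- Membership in `holomorphicForms`. -/
theorem mem_holomorphicForms {f : PeterssonForms hQ S hS k hD} :
    f ∈ holomorphicForms hQ S hS k hD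
      ↔ DifferentiableOn ℂ (PeterssonForms.toForm hQ S hS k hD f : (Fin 2 → ℂ) → ℂ) ball₂ :=
  Iff.rfl

/-- **The holomorphic part of the Petersson space**: the image of the holomorphic weight-`k`
forms in `PeterssonSpace` (`S_k(S)` inside `L²_k(S\𝔹²)`). -/
noncomputable def holomorphicSpace : Submodule ℂ (PeterssonSpace hQ S hS k hD) :=
  (holomorphicForms hQ S hS k hD).map
    (SeparationQuotient.mkCLM ℂ (PeterssonForms hQ S hS k hD)).toLinearMap

/-- The class of a holomorphic form lies in the holomorphic part. -/
theorem mk_mem_holomorphicSpace {f : PeterssonForms hQ S hS k hD}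
    (hf : f ∈ holomorphicForms hQ S hS k hD) :
    (SeparationQuotient.mk f : PeterssonSpace hQ S hS k hD) ∈ holomorphicSpace hQ S hS k hD :=
  ⟨f, hf, rfl⟩

section hecke

variable {δ : GL (Fin 3) K} (hδ : δ ∈ unitaryGroup K H)
  [Fintype (S ⧸ (heckeSubgroup S δ).subgroupOf S)]

/-- `T_δ` preserves the holomorphic forms. -/
theorem heckeForms_mem_holomorphicForms {f : PeterssonForms hQ S hS k hD}
    (hf : f ∈ holomorphicForms hQ S hS k hD) :
    heckeForms hQ S hS k hD hδ f ∈ holomorphicForms hQ S hS k hD :=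
  differentiableOn_hecke hQ hS k hδ hf

variable [Fintype (S ⧸ (heckeSubgroup S δ⁻¹).subgroupOf S)]

/-- `T_δ` on the Petersson space preserves the holomorphic part. -/
theorem heckeSpace_mem_holomorphicSpace (hDm : MeasurableSet D)
    {v : PeterssonSpace hQ S hS k hD} (hv : v ∈ holomorphicSpace hQ S hS k hD) :
    heckeSpace hQ S hS k hD hδ hDm v ∈ holomorphicSpace hQ S hS k hD := by
  obtain ⟨f, hf, rfl⟩ := hv
  exact ⟨heckeForms hQ S hS k hD hδ f, heckeForms_mem_holomorphicForms hQ S hS k hD hδ hf, rfl⟩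

end hecke

section eigenforms

variable {𝔪 : Submodule ℤ (Fin 3 → K)} (h𝔪 : IsLattice K 𝔪) (hS₁ : S ≤ shimuraLevelSubgroup K H 𝔪 1)
  {N' : ℕ} (hN' : N' ≠ 0) (hSN' : shimuraLevelSubgroup K H 𝔪 N' ≤ S) (hDm : MeasurableSet D)

/-- Every Hecke operator `T_δ`, `δ ∈ U(H)(K)`, preserves the holomorphic part of the Petersson
space of a congruence subgroup. -/
theorem heckeFamily_mem_holomorphicSpace (δ : unitaryGroup K H) :
    ∀ v ∈ holomorphicSpace hQ S hS k hD,
      heckeFamily hQ S hS k hD h𝔪 hS₁ hN' hSN' hDm δ v ∈ holomorphicSpace hQ S hS k hD := by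
  intro v hv
  letI := fintypeHeckeQuotient h𝔪 hS₁ hN' hSN' δ.2
  letI := fintypeHeckeQuotient h𝔪 hS₁ hN' hSN' (inv_mem δ.2)
  exact heckeSpace_mem_holomorphicSpace hQ S hS k hD δ.2 hDm hv

/-- **Simultaneous Hecke eigenforms in the holomorphic forms.** If the holomorphic part of the
Petersson space of the congruence subgroup `Γ_{N'} ≤ S ≤ Γ_1` (compact quotient) is
finite-dimensional, then for any family of rational unitary matrices closed under inversion whose
Hecke operators commute pairwise, it has an orthonormal basis of simultaneous Hecke eigenforms. -/
theorem exists_orthonormalBasis_heckeSpace_holomorphic {ι : Type*} (δ : ι → unitaryGroup K H)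
    (σ : ι → ι) (hσ : ∀ i, δ (σ i) = (δ i)⁻¹)
    (hcomm : ∀ i j, Commute (heckeFamily hQ S hS k hD h𝔪 hS₁ hN' hSN' hDm (δ i))
      (heckeFamily hQ S hS k hD h𝔪 hS₁ hN' hSN' hDm (δ j)))
    [FiniteDimensional ℂ (holomorphicSpace hQ S hS k hD)] :
    ∃ b : OrthonormalBasis (Fin (Module.finrank ℂ (holomorphicSpace hQ S hS k hD))) ℂ
        (holomorphicSpace hQ S hS k hD), ∀ a i, ∃ μ : ℂ,
      heckeFamily hQ S hS k hD h𝔪 hS₁ hN' hSN' hDm (δ i) (b a)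
        = μ • (b a : PeterssonSpace hQ S hS k hD) :=
  exists_orthonormalBasis_heckeSpace hQ S hS k hD h𝔪 hS₁ hN' hSN' hDm δ σ hσ hcomm _
    (fun i => heckeFamily_mem_holomorphicSpace hQ S hS k hD h𝔪 hS₁ hN' hSN' hDm (δ i))

end eigenforms

end Summit.Ventures.HodgeRepro2.ShimuraData
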